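import Summits.ResolutionOfSingularities.ResolutionOfSingularities.Theorems.EquisingularLiftEquisingularLiftNatChartLiftPatching
import HarnessLib

/-!
# [OURS · L1 W4.5(b) · EL♮(3) · WIDTH TABLE D8 «NODAL HOSTED ROUND (HR-KEEP-N)», support debt S-D8-LIFT, part 4 (C3)] THE GLOBAL TWIST OF A FLAT LIFT
# BY A GLOBAL NORMAL SECTION — R. Hartshorne, *Deformation Theory* (2010), Thm. 6.2 (a), SHEAF LEVEL: `exists_idealSheafData_twist`

res-L1-w45b-stub-4 g14 (desk R69 (iii) / DESK WORD g25-19; split of record STATUS 2026-08-29T04:20:51Z, brick (C3)).  OURS; NOT a statement of any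
manuscript ([Hironaka2017] is a candidate under adjudication, nothing of it is asserted); AI-written, weaker than expert review.  No `sorry`; standard
axioms; DEF-FREE.  `--supports stmt-ResolutionOfSingularities-20148 --as helper`.

WHAT.  In the currency of the patching engine (π) ✓ `exists_idealSheafData_comap_eq_ker_and_flat` (…NatChartLiftPatching, res-type-027 g17): one principal
small extension `t : X_n ↪ X_{n+1}` of infinitesimal neighbourhoods of `f : X ⟶ Spec A` along `I` (base kernel `(ε)`, `ann ε = 𝔪 ∋ ε` nilpotent), the
closed `jn : Y_n ↪ X_n` with special fibre `ι : Y₀ ↪ X₀` over a fibre model `(j₀, t₀)` of `q : A ↠ k₀`.  GIVEN a flat lift of `Y_n` to `X_{n+1}` AS AN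
IDEAL SHEAF `G` (`G.comap t = jn.ker`, `V(G) → Spec (A/I^{n+2})` flat), lci traces on small affine charts everywhere, and a GLOBAL section
`ψ ∈ Γ(Y₀, 𝒩)` of the normal sheaf of `ι`, THERE IS the twisted lift `G_ψ`: again `G_ψ.comap t = jn.ker` and `V(G_ψ)` flat, and on EVERY affine chart `U`
with an lci trace the difference section of `(G(U), G_ψ(U))` is `ψ|` (F5 `IsDiffSec`).  This is the transitivity half of Hartshorne's Thm. 6.2 (a)
(«the set of extensions is a (pseudo)torsor under `H⁰(Y₀, 𝒩₀ ⊗ J)`») at the SHEAF level; the engine (π) only needed the chartwise action.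
* `isChartLift_ideal_of_comap_eq_ker_of_flat` — a global flat lift is a chart lift (F6a `IsChartLift`) on each affine chart: flatness of the chart ring
  quotient from `Flat (V(G) → Spec)` through the chart `Spec (Γ(U)/G(U)) → V(G)` (B2 ✓ `subschemeCover_f_subschemeι_comp`), the chart clause from
  `G.comap t = jn.ker` (B1 ✓ `comap_ideal_chart`, ✓ `ker_ideal_chart`).
* ★ `exists_idealSheafData_twist` — the twist.  Proof: on every lci affine chart `U` act on `G(U)` by `ψ|` (F5 ✓ `exists_isChartLift_isDiffSec`); two
  such twisted chart ideals AGREE on every affine `U' ≤ U_a ∩ U_b` because their difference section is `−ψ| + ψ| = 0` (F5 ✓ `isDiffSec_restrict_of_isChartLift`,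
  `isDiffSec_neg/add_of_isChartLift`, detection ✓ `eq_of_isDiffSec_zero_of_isChartLift`; `G(U_a)·Γ(U') = G(U') = G(U_b)·Γ(U')` by Mathlib `map_ideal`);
  glue (F3 ✓ `exists_idealSheafData_forall_ideal_eq_family`); `comap t = jn.ker` and flatness on the chart cover exactly as in the engine.
USE (part 4 (C6)): at `n = 0` the first-order lift `Y₁⁰` of the special fibre `Z̃` (J1 ✓) is twisted by `c·ψ`, `ψ` the (N4) section and `c ∈ k` off the
finitely many bad residues at the non-regular points (N1), so that the restarted (F)-assembly (res-L1-w45b-nose-w1's (N-C4)) returns a lift with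
REGULAR total space.
[cite: Hartshorne2010, Thm. 6.2 (a) (proof pp. 47–48)] [folklore; sheaf-level bookkeeping over the cited tree bricks]
-/

set_option linter.dupNamespace false -- mandated namespace `Summit.<Summit>.<Problem>` of this single-conjunct summit
-- `TopCat.Presheaf`/`Scheme.Modules` are not reducible (as in Mathlib's `AlgebraicGeometry/Modules` and the tree's `Modules/*`).
set_option backward.isDefEq.respectTransparency false

noncomputable section

open CategoryTheory CategoryTheory.Limits AlgebraicGeometry Opposite TopologicalSpace
open Literature.AlgebraicGeometry.Morphisms Literature.AlgebraicGeometry.Modules Literature.AlgebraicGeometry.Deformation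
open Literature.AlgebraicGeometry.HodgeTheory

namespace Summit.ResolutionOfSingularities.ResolutionOfSingularities.Cruxes.EquisingularLiftNat.Sections

universe u

/-! ## A global flat lift is a chart lift on every affine chart -/

section ChartOfGlobal

variable {A : Type} [CommRing A] {I : Ideal A} {X : Scheme.{0}} {f : X ⟶ Spec (.of A)} {n : ℕ}
  {Yn : Scheme.{0}} {jn : Yn ⟶ infinitesimalNeighbourhood I f n} [IsClosedImmersion jn]

/-- **A global flat lift is a chart lift on every affine chart.**  If `G` is an ideal sheaf on `X_{n+1}` with `G.comap t = jn.ker` and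
`V(G) → Spec (A/I^{n+2})` flat, then `G(U)` is an F6a chart lift of `Y_n` on every affine chart `U`. [folklore] -/
theorem isChartLift_ideal_of_comap_eq_ker_of_flat (G : (infinitesimalNeighbourhood I f (n + 1)).IdealSheafData)
    (hG : G.comap (infinitesimalNeighbourhood.transition I f n) = jn.ker)
    (hGflat : Flat (G.subschemeι ≫ infinitesimalNeighbourhood.toSpec I f (n + 1)))
    (U : (infinitesimalNeighbourhood I f (n + 1)).affineOpens) : IsChartLift I f n jn U (G.ideal U) := by
  haveI ht := isClosedImmersion_transition I f n
  haveI : IsAffineHom (infinitesimalNeighbourhood.transition I f n) := inferInstance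
  constructor
  · -- flatness of `Γ(U)/G(U)` over `A/I^{n+2}`: the chart `Spec (Γ(U)/G(U)) → V(G) → Spec` is flat
    letI := chartAlg I f (n + 1) U
    haveI := hGflat
    have hflatc : Flat (G.subschemeCover.openCover.f U ≫ G.subschemeι ≫ infinitesimalNeighbourhood.toSpec I f (n + 1)) := inferInstance
    rw [subschemeCover_f_subschemeι_comp (infinitesimalNeighbourhood.toSpec I f (n + 1)) G U, ← Spec.map_comp_assoc] at hflatc
    haveI : IsIso (isAffineOpen_top (Spec (.of (A ⧸ I ^ (n + 1 + 1))))).fromSpec := by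
      rw [← IsAffineOpen.isoSpec_inv_ι, ← Scheme.topIso_hom]; infer_instance
    have hflat' : Flat (Spec.map ((infinitesimalNeighbourhood.toSpec I f (n + 1)).appLE ⊤ U le_top ≫
        CommRingCat.ofHom (Ideal.Quotient.mk (G.ideal U)))) :=
      (MorphismProperty.cancel_right_of_respectsIso @Flat _ (isAffineOpen_top (Spec _)).fromSpec).mp hflatc
    rw [HasRingHomProperty.Spec_iff (P := @Flat)] at hflat'
    -- `hflat'` : the ring map `Γ(Spec, ⊤) → Γ(U) → Γ(U)/G(U)` is flat; compose with `ΓSpecIso⁻¹`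
    have h2 := RingHom.Flat.comp (RingHom.Flat.of_bijective (ConcreteCategory.bijective_of_isIso (Scheme.ΓSpecIso (.of (A ⧸ I ^ (n + 1 + 1)))).inv))
      hflat'
    have h3 : ((Ideal.Quotient.mk (G.ideal U)).comp (algebraMap (A ⧸ I ^ (n + 1 + 1)) Γ(infinitesimalNeighbourhood I f (n + 1), U))).Flat := by
      rw [algebraMap_chartAlg, ← RingHom.comp_assoc]
      exact h2
    rw [Ideal.Quotient.mk_comp_algebraMap] at h3
    exact RingHom.flat_algebraMap_iff.mp h3
  · -- the chart clause from `G.comap t = jn.ker`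
    have h1 := congrArg (fun K : (infinitesimalNeighbourhood I f n).IdealSheafData =>
      K.ideal (⟨(infinitesimalNeighbourhood.transition I f n) ⁻¹ᵁ (U : (infinitesimalNeighbourhood I f (n + 1)).Opens), U.2.preimage _⟩ :
        (infinitesimalNeighbourhood I f n).affineOpens)) hG
    simp only at h1
    rw [comap_ideal_chart (infinitesimalNeighbourhood.transition I f n) G U, ker_ideal_chart (infinitesimalNeighbourhood.transition I f n) jn U,
      Scheme.Hom.appLE_eq_app] at h1
    exact h1

end ChartOfGlobal

/-! ## The global twist -/

section Twist

variable {A : Type} [CommRing A] {I : Ideal A} {X : Scheme.{0}} {f : X ⟶ Spec (.of A)} {n : ℕ} {k₀ : Type} [CommRing k₀] {q : A →+* k₀}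
  {hq : Function.Surjective q} {hI : I ≤ RingHom.ker q} {X₀ : Scheme.{0}} {j₀ : X₀ ⟶ X} {t₀ : X₀ ⟶ Spec (.of k₀)}
  {hsq : IsPullback j₀ t₀ f (Spec.map (CommRingCat.ofHom q))} {Yn Y₀ : Scheme.{0}} {jn : Yn ⟶ infinitesimalNeighbourhood I f n}
  [IsClosedImmersion jn] {ι : Y₀ ⟶ X₀} [IsClosedImmersion ι] [IsLocallyNoetherian X₀] {s₀ : Y₀ ⟶ Yn}
  (hs₀ : IsPullback s₀ ι (jn ≫ infinitesimalNeighbourhood.ι I f n) j₀)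
  {ε : A ⧸ I ^ (n + 1 + 1)} (hkert : RingHom.ker (infinitesimalNeighbourhood.transitionRingHom I n) = Ideal.span {ε})
  (hann : ∀ c : A ⧸ I ^ (n + 1 + 1), ε * c = 0 ↔ c ∈ (RingHom.ker q).map (Ideal.Quotient.mk (I ^ (n + 1 + 1))))
  (hεm : ε ∈ (RingHom.ker q).map (Ideal.Quotient.mk (I ^ (n + 1 + 1))))
  (hnil : IsNilpotent ((RingHom.ker q).map (Ideal.Quotient.mk (I ^ (n + 1 + 1)))))

include hs₀ hkert hann hεm hnil in
/-- ★ **THE GLOBAL TWIST OF A FLAT LIFT BY A GLOBAL NORMAL SECTION** (Hartshorne 2010, Thm. 6.2 (a), sheaf level).  In the setting of the patching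
engine (π): given a flat lift `G` of `Y_n` to `X_{n+1}` as an ideal sheaf (`G.comap t = jn.ker`, `V(G)` flat over `A/I^{n+2}`), lci traces on small
affine charts around every point, and a global section `ψ` of the normal sheaf `𝒩` of `ι : Y₀ ↪ X₀`, there is an ideal sheaf `G'` with
`G'.comap t = jn.ker`, `V(G')` flat, and, on every affine chart `U` with an lci trace, `IsDiffSec ι ε π_U (G(U)) (G'(U)) (ψ|)` — the difference section
of the two lifts on `U` is the restriction of `ψ`.  See the module docstring for the proof.
[cite: Hartshorne2010, Thm. 6.2 (a) (proof pp. 47–48)] [OURS · L1 W4.5b · WIDTH TABLE D8, support debt S-D8-LIFT, brick (C3)] -/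
theorem exists_idealSheafData_twist (G : (infinitesimalNeighbourhood I f (n + 1)).IdealSheafData)
    (hG : G.comap (infinitesimalNeighbourhood.transition I f n) = jn.ker)
    (hGflat : Flat (G.subschemeι ≫ infinitesimalNeighbourhood.toSpec I f (n + 1)))
    (hcharts : ∀ x : infinitesimalNeighbourhood I f (n + 1), ∃ U : (infinitesimalNeighbourhood I f (n + 1)).affineOpens,
      x ∈ (U : (infinitesimalNeighbourhood I f (n + 1)).Opens) ∧ HasLciTrace I f n q hq hI hsq ι U)
    (ψ : Γ(normalSheaf ι, ⊤)) :
    ∃ G' : (infinitesimalNeighbourhood I f (n + 1)).IdealSheafData,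
      G'.comap (infinitesimalNeighbourhood.transition I f n) = jn.ker ∧
        Flat (G'.subschemeι ≫ infinitesimalNeighbourhood.toSpec I f (n + 1)) ∧
        ∀ (U : (infinitesimalNeighbourhood I f (n + 1)).affineOpens), HasLciTrace I f n q hq hI hsq ι U →
          letI := chartAlg I f (n + 1) U
          IsDiffSec ι ε (traceHom I f n q hI hsq U) (G.ideal U) (G'.ideal U)
            (MSections.res Y₀.toSpecΓ (normalSheaf ι) (le_top : ι ⁻¹ᵁ (traceChart I f n q hq hI hsq U : X₀.Opens) ≤ ⊤) ψ) := by
  classical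
  haveI hfE := isClosedImmersion_fibreEmb I f q hI hsq hq n
  haveI ht := isClosedImmersion_transition I f n
  -- `G` is a chart lift on every affine chart
  have hGch : ∀ U : (infinitesimalNeighbourhood I f (n + 1)).affineOpens, IsChartLift I f n jn U (G.ideal U) := fun U =>
    isChartLift_ideal_of_comap_eq_ker_of_flat G hG hGflat U
  -- the restrictions of `ψ`
  let ψr : ∀ U : (infinitesimalNeighbourhood I f (n + 1)).affineOpens,
      ((conormalSheaf ι).over (ι ⁻¹ᵁ (traceChart I f n q hq hI hsq U : X₀.Opens)) ⟶ (unitModule Y₀).over (ι ⁻¹ᵁ (traceChart I f n q hq hI hsq U : X₀.Opens))) :=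
    fun U => MSections.res Y₀.toSpecΓ (normalSheaf ι) (le_top : ι ⁻¹ᵁ (traceChart I f n q hq hI hsq U : X₀.Opens) ≤ ⊤) ψ
  have hψr : ∀ U, ψr U = MSections.res Y₀.toSpecΓ (normalSheaf ι) (le_top : ι ⁻¹ᵁ (traceChart I f n q hq hI hsq U : X₀.Opens) ≤ ⊤) ψ := fun _ => rfl
  have hrestr : ∀ {B C : Y₀.Opens} (h : B ≤ C) (μ : (conormalSheaf ι).over C ⟶ (unitModule Y₀).over C),
      restrictHom (homOfLE h) μ = MSections.res Y₀.toSpecΓ (normalSheaf ι) h μ := fun h μ => rfl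
  have hψres : ∀ {U U' : (infinitesimalNeighbourhood I f (n + 1)).affineOpens} (hle : (U' : (infinitesimalNeighbourhood I f (n + 1)).Opens) ≤ U),
      MSections.res Y₀.toSpecΓ (normalSheaf ι) (ι.preimage_mono (traceChart_mono I f n q hq hI hsq hle)) (ψr U) = ψr U' := by
    intro U U' hle
    rw [hψr, hψr, MSections.res_res]
  -- the small charts: affine with an lci trace
  let S : Type := {U : (infinitesimalNeighbourhood I f (n + 1)).affineOpens // HasLciTrace I f n q hq hI hsq ι U}
  let 𝒰 : S → (infinitesimalNeighbourhood I f (n + 1)).Opens := fun a => (a.1 : (infinitesimalNeighbourhood I f (n + 1)).Opens)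
  have hS : ∀ x : infinitesimalNeighbourhood I f (n + 1), ∃ a : S, x ∈ 𝒰 a := by
    intro x
    obtain ⟨U, hxU, hl⟩ := hcharts x
    exact ⟨⟨U, hl⟩, hxU⟩
  -- the twisted chart ideals
  have hJ'ex := fun a : S => exists_isChartLift_isDiffSec (hq := hq) hs₀ hkert hann hεm (hGch a.1) (ψr a.1)
  choose J' hJ'lift hJ'diff using hJ'ex
  -- restriction of ideals composes
  have hJmm : ∀ {U₁ U₂ U₃ : (infinitesimalNeighbourhood I f (n + 1)).Opens} (h₁₂ : U₂ ≤ U₁) (h₂₃ : U₃ ≤ U₂)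
      (K : Ideal Γ(infinitesimalNeighbourhood I f (n + 1), U₁)),
      (K.map ((infinitesimalNeighbourhood I f (n + 1)).presheaf.map (homOfLE h₁₂).op).hom).map
          ((infinitesimalNeighbourhood I f (n + 1)).presheaf.map (homOfLE h₂₃).op).hom =
        K.map ((infinitesimalNeighbourhood I f (n + 1)).presheaf.map (homOfLE (h₂₃.trans h₁₂)).op).hom := fun h₁₂ h₂₃ K => by
    rw [Ideal.map_map, ← CommRingCat.hom_comp, ← Functor.map_comp]
    rfl
  -- the twisted chart ideals agree on the overlaps
  have hagree : ∀ (a b : S) (U : (infinitesimalNeighbourhood I f (n + 1)).Opens) (hU : IsAffineOpen U) (ha : U ≤ 𝒰 a) (hb : U ≤ 𝒰 b),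
      (J' a).map ((infinitesimalNeighbourhood I f (n + 1)).presheaf.map (homOfLE ha).op).hom =
        (J' b).map ((infinitesimalNeighbourhood I f (n + 1)).presheaf.map (homOfLE hb).op).hom := by
    intro a b U hU ha hb
    have hla : HasLciTrace I f n q hq hI hsq ι a.1 := a.2
    have hlb : HasLciTrace I f n q hq hI hsq ι b.1 := b.2
    -- `G(U_a)·Γ(U) = G(U) = G(U_b)·Γ(U)`
    have hGa : (G.ideal a.1).map ((infinitesimalNeighbourhood I f (n + 1)).presheaf.map (homOfLE ha).op).hom = G.ideal ⟨U, hU⟩ :=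
      G.map_ideal' (U := ⟨U, hU⟩) (V := a.1) (homOfLE ha).op
    have hGb : (G.ideal b.1).map ((infinitesimalNeighbourhood I f (n + 1)).presheaf.map (homOfLE hb).op).hom = G.ideal ⟨U, hU⟩ :=
      G.map_ideal' (U := ⟨U, hU⟩) (V := b.1) (homOfLE hb).op
    have hJ'aU := (hJ'lift a).restrict (U' := ⟨U, hU⟩) ha
    have hJ'bU := (hJ'lift b).restrict (U' := ⟨U, hU⟩) hb
    have hGU := hGch ⟨U, hU⟩
    -- `diff(J'a|, G|) = −ψ|`
    have s₁ := by
      have h := isDiffSec_neg_of_isChartLift (U := a.1) hkert hεm (hJ'diff a)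
      have h' := isDiffSec_restrict_of_isChartLift (U := a.1) (U' := ⟨U, hU⟩) hs₀ hkert hann hεm ha hla (hJ'lift a) (hGch a.1) h
      rw [hGa] at h'
      exact h'
    -- `diff(G|, J'b|) = ψ|`
    have s₃ := by
      have h' := isDiffSec_restrict_of_isChartLift (U := b.1) (U' := ⟨U, hU⟩) hs₀ hkert hann hεm hb hlb (hGch b.1) (hJ'lift b) (hJ'diff b)
      rw [hGb] at h'
      exact h'
    have s₁₃ := isDiffSec_add_of_isChartLift (hq := hq) (U := ⟨U, hU⟩) hs₀ hkert hann hεm hJ'aU hGU hJ'bU s₁ s₃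
    -- the total section vanishes
    have hzero : restrictHom (homOfLE (ι.preimage_mono (traceChart_mono I f n q hq hI hsq (U' := ⟨U, hU⟩) ha))) (-ψr a.1) +
        restrictHom (homOfLE (ι.preimage_mono (traceChart_mono I f n q hq hI hsq (U' := ⟨U, hU⟩) hb))) (ψr b.1) = 0 := by
      rw [hrestr, hrestr, map_neg, hψres ha, hψres hb, neg_add_cancel]
    rw [hzero] at s₁₃
    exact eq_of_isDiffSec_zero_of_isChartLift (hq := hq) (U := ⟨U, hU⟩) hs₀ hkert hann hεm hnil hJ'aU hJ'bU s₁₃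
  -- glue the twisted chart ideals (F3)
  let F : S → ∀ U' : (infinitesimalNeighbourhood I f (n + 1)).affineOpens, Ideal Γ(infinitesimalNeighbourhood I f (n + 1), U') := fun a U' =>
    if h : (U' : (infinitesimalNeighbourhood I f (n + 1)).Opens) ≤ 𝒰 a then (J' a).map ((infinitesimalNeighbourhood I f (n + 1)).presheaf.map (homOfLE h).op).hom else ⊤
  have hFdef : ∀ (a : S) (U' : (infinitesimalNeighbourhood I f (n + 1)).affineOpens) (h : (U' : (infinitesimalNeighbourhood I f (n + 1)).Opens) ≤ 𝒰 a),
      F a U' = (J' a).map ((infinitesimalNeighbourhood I f (n + 1)).presheaf.map (homOfLE h).op).hom :=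
    fun a U' h => dif_pos h
  obtain ⟨G', hG'⟩ := exists_idealSheafData_forall_ideal_eq_family 𝒰 hS F
    (fun a U' U'' hU' h => by rw [hFdef a U' hU', hFdef a U'' (h.trans hU')]; exact hJmm hU' h (J' a))
    (fun a b U' hU' => by rw [hFdef a U' (hU'.trans inf_le_left), hFdef b U' (hU'.trans inf_le_right)]; exact hagree a b U' U'.2 _ _)
  have hG'a : ∀ a : S, G'.ideal a.1 = J' a := fun a => by
    rw [hG' a a.1 le_rfl, hFdef a a.1 le_rfl]
    exact ideal_map_presheaf_map_refl a.1 (J' a)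
  refine ⟨G', ?_, ?_, ?_⟩
  · -- `G'.comap t = jn.ker`, checked on the chart cover `t⁻¹(𝒰 a)`
    refine Scheme.IdealSheafData.ext_of_iSup_eq_top (fun a : S => (⟨(infinitesimalNeighbourhood.transition I f n) ⁻¹ᵁ 𝒰 a, a.1.2.preimage (infinitesimalNeighbourhood.transition I f n)⟩ :
        (infinitesimalNeighbourhood I f n).affineOpens))
      ?_ fun a => ?_
    · refine top_le_iff.mp fun y _ => ?_
      obtain ⟨a, ha⟩ := hS ((infinitesimalNeighbourhood.transition I f n).base y)
      exact Opens.mem_iSup.mpr ⟨a, ha⟩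
    · rw [comap_ideal_chart (infinitesimalNeighbourhood.transition I f n) G' a.1, hG'a a, ker_ideal_chart (infinitesimalNeighbourhood.transition I f n) jn a.1,
        Scheme.Hom.appLE_eq_app]
      exact (hJ'lift a).map_app_transition
  · -- flatness on the chart cover
    let 𝒱 : G'.subscheme.OpenCover := Scheme.Cover.mkOfCovers S (fun a => G'.subschemeCover.openCover.X a.1)
      (fun a => G'.subschemeCover.openCover.f a.1) (fun y => by
        obtain ⟨a, ha⟩ := hS (G'.subschemeι.base y)
        have hy : y ∈ (G'.subschemeCover.f a.1).opensRange := by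
          rw [G'.opensRange_subschemeCover_map a.1]; exact ha
        obtain ⟨x, hx⟩ := hy
        exact ⟨a, x, hx⟩) inferInstance
    refine IsZariskiLocalAtSource.of_openCover (P := @Flat) 𝒱 fun a => ?_
    change Flat (G'.subschemeCover.openCover.f a.1 ≫ G'.subschemeι ≫ infinitesimalNeighbourhood.toSpec I f (n + 1))
    have e := subschemeCover_f_subschemeι_comp (infinitesimalNeighbourhood.toSpec I f (n + 1)) G' a.1
    rw [← Spec.map_comp_assoc] at e
    rw [e]
    have hflatU : ((Ideal.Quotient.mk (G'.ideal a.1)).comp ((infinitesimalNeighbourhood.toSpec I f (n + 1)).appLE ⊤ a.1 le_top).hom).Flat := by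
      letI := chartAlg I f (n + 1) a.1
      rw [hG'a a]
      haveI := (hJ'lift a).flat
      have h1 : (algebraMap (A ⧸ I ^ (n + 1 + 1)) (Γ(infinitesimalNeighbourhood I f (n + 1), a.1) ⧸ J' a)).Flat := RingHom.flat_algebraMap_iff.mpr inferInstance
      rw [← Ideal.Quotient.mk_comp_algebraMap, algebraMap_chartAlg] at h1
      have h2 := RingHom.Flat.comp (RingHom.Flat.of_bijective (ConcreteCategory.bijective_of_isIso (Scheme.ΓSpecIso (.of (A ⧸ I ^ (n + 1 + 1)))).hom)) h1
      rw [RingHom.comp_assoc, RingHom.comp_assoc, ← CommRingCat.hom_comp, Iso.hom_inv_id, CommRingCat.hom_id, RingHom.comp_id] at h2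
      exact h2
    haveI : Flat (Spec.map ((infinitesimalNeighbourhood.toSpec I f (n + 1)).appLE ⊤ a.1 le_top ≫ CommRingCat.ofHom (Ideal.Quotient.mk (G'.ideal a.1)))) := by
      rw [HasRingHomProperty.Spec_iff (P := @Flat)]
      exact hflatU
    exact MorphismProperty.comp_mem _ _ _ this (inferInstanceAs (Flat (isAffineOpen_top (Spec _)).fromSpec))
  · -- the difference sections on the lci charts
    intro U hU
    have h := hJ'diff ⟨U, hU⟩
    rw [← hG'a ⟨U, hU⟩] at h
    exact h

end Twist

end Summit.ResolutionOfSingularities.ResolutionOfSingularities.Cruxes.EquisingularLiftNat.Sections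

end
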